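import Summits.Ventures.Crystal3D.StickySpheres.RadiusOne
import HarnessLib

/-!
# Four balls: `C(4) = 6`, and the maximiser (the regular tetrahedron) has an exposed triangle

Venture `Crystal3D` (cell `pub-crystal3d`, seat p2). The BASE CASE of the Bezdek–Khan induction
(`StickySpheres/SmallContactInduction.lean`, `maxContacts_eq_of_enumeration` with `n₁ = 4`), proved outright:
* `six_le_maxContacts_four` (fcc integer model `(0,0,0),(1,1,0),(1,0,1),(0,1,1)` at scale `1/√2`),
  `numContacts_le_six_of_four`, `maxContacts_three_four : C(4) = 6`;
* `dist_eq_one_of_numContacts_eq_six` — a four-ball packing with six contacts is pairwise touching;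
* `exists_docking_of_pairwise_touching` — for four pairwise touching unit-diameter balls `a, b, c, p` the reflected
  apex `q = (2/3)(a + b + c) − p` is at distance `1` from `a, b, c` and `√(8/3)` from `p`: a docking point with three
  new contacts (an "exposed triangle").
HONEST FRAMING: elementary Euclidean geometry; nothing enumerative and nothing about crystallization.
-/

noncomputable section

open Finset RealInnerProductSpace
open scoped BigOperators

namespace Summit.Ventures.Crystal3D

open Literature.Geometry.DiscreteGeometry (sqNormInt)
open Literature.Barriers.AtomisticToContinuum (intContactNumber intConfig)

/-! ### 1. `C(4) = 6` -/

/-- The fcc tetrahedron as an integer model (contact at squared distance `2`). [folklore] -/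
def tetraInt : Fin 4 → Fin 3 → ℤ := ![![0, 0, 0], ![1, 1, 0], ![1, 0, 1], ![0, 1, 1]]

/-- All six pairs of `tetraInt` are at squared distance `2`. [folklore] -/
theorem intContactNumber_tetra : intContactNumber tetraInt 2 = 6 := by decide +kernel

/-- Separation of `tetraInt`. [folklore] -/
theorem sep_tetra : ∀ i j : Fin 4, i ≠ j → (2 : ℤ) ≤ sqNormInt (tetraInt i - tetraInt j) := by decide +kernel

/-- `6 ≤ C(4)` (regular tetrahedron). [folklore] -/
theorem six_le_maxContacts_four : 6 ≤ maxContacts 3 4 :=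
  le_maxContacts_of_intConfig tetraInt (by norm_num) sep_tetra intContactNumber_tetra

/-- The six label pairs `i < j` of `Fin 4`. [folklore] -/
theorem card_pairs_four : ((univ : Finset (Fin 4 × Fin 4)).filter fun p => p.1 < p.2).card = 6 := by decide

variable {d : ℕ}

/-- A configuration of four balls has at most six contacts. [folklore] -/
theorem numContacts_le_six_of_four (x : Fin 4 → EuclideanSpace ℝ (Fin d)) : numContacts x ≤ 6 := by
  classical
  rw [numContacts, ← card_pairs_four]
  exact card_le_card fun p hp => mem_filter.2 ⟨mem_univ _, ((mem_contactPairs x).1 hp).1⟩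

/-- **`C(4) = 6`.** [folklore] -/
theorem maxContacts_three_four : maxContacts 3 4 = 6 :=
  le_antisymm (maxContacts_le (by norm_num) fun x _ => numContacts_le_six_of_four x) six_le_maxContacts_four

/-- **Six contacts among four balls means pairwise touching.** [folklore] -/
theorem dist_eq_one_of_numContacts_eq_six {x : Fin 4 → EuclideanSpace ℝ (Fin d)} (h6 : numContacts x = 6)
    {i j : Fin 4} (hij : i ≠ j) : dist (x i) (x j) = 1 := by
  classical
  have hsub : contactPairs x ⊆ (univ : Finset (Fin 4 × Fin 4)).filter fun p => p.1 < p.2 :=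
    fun p hp => mem_filter.2 ⟨mem_univ _, ((mem_contactPairs x).1 hp).1⟩
  have heq : contactPairs x = (univ : Finset (Fin 4 × Fin 4)).filter fun p => p.1 < p.2 :=
    eq_of_subset_of_card_le hsub (by rw [card_pairs_four, ← h6]; rfl)
  rcases lt_or_gt_of_ne hij with hlt | hlt
  · have : (i, j) ∈ contactPairs x := by rw [heq]; exact mem_filter.2 ⟨mem_univ _, hlt⟩
    exact ((mem_contactPairs x).1 this).2
  · have : (j, i) ∈ contactPairs x := by rw [heq]; exact mem_filter.2 ⟨mem_univ _, hlt⟩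
    rw [dist_comm]; exact ((mem_contactPairs x).1 this).2

/-! ### 2. The reflected apex is a docking point -/

/-- Inner product of two unit edges from a common vertex of a unit triangle is `1/2`. [folklore] -/
theorem inner_eq_half_of_unit_triangle {a b c : EuclideanSpace ℝ (Fin d)} (hab : dist a b = 1) (hac : dist a c = 1)
    (hbc : dist b c = 1) : ⟪b - a, c - a⟫ = 1 / 2 := by
  have h1 : ‖b - a‖ = 1 := by rw [← dist_eq_norm, dist_comm, hab]
  have h2 : ‖c - a‖ = 1 := by rw [← dist_eq_norm, dist_comm, hac]
  have h3 : ‖(b - a) - (c - a)‖ = 1 := by rw [sub_sub_sub_cancel_right, ← dist_eq_norm, hbc]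
  have e := norm_sub_sq_real (b - a) (c - a)
  rw [h1, h2, h3] at e
  linarith

/-- **The reflected apex.** For four pairwise touching unit-diameter balls `a, b, c, p`, the point
`q = a + (2/3)(b − a) + (2/3)(c − a) − (p − a)` (the reflection of `p` in the plane of `a, b, c`) satisfies
`dist q a = dist q b = dist q c = 1` and `dist q p = √(8/3) ≥ 1`. [folklore] -/
theorem reflected_apex_dist {a b c p : EuclideanSpace ℝ (Fin d)} (hab : dist a b = 1) (hac : dist a c = 1)
    (hbc : dist b c = 1) (hpa : dist p a = 1) (hpb : dist p b = 1) (hpc : dist p c = 1) :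
    let q := a + ((2 / 3 : ℝ) • (b - a) + (2 / 3 : ℝ) • (c - a) - (p - a))
    dist q a = 1 ∧ dist q b = 1 ∧ dist q c = 1 ∧ dist q p ^ 2 = 8 / 3 := by
  intro q
  -- Gram data of w1 = b - a, w2 = c - a, w3 = p - a
  obtain ⟨w1, hw1⟩ : ∃ w1 : EuclideanSpace ℝ (Fin d), w1 = b - a := ⟨_, rfl⟩
  obtain ⟨w2, hw2⟩ : ∃ w2 : EuclideanSpace ℝ (Fin d), w2 = c - a := ⟨_, rfl⟩
  obtain ⟨w3, hw3⟩ : ∃ w3 : EuclideanSpace ℝ (Fin d), w3 = p - a := ⟨_, rfl⟩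
  have n1 : ⟪w1, w1⟫ = 1 := by rw [real_inner_self_eq_norm_sq, hw1, ← dist_eq_norm, dist_comm, hab]; norm_num
  have n2 : ⟪w2, w2⟫ = 1 := by rw [real_inner_self_eq_norm_sq, hw2, ← dist_eq_norm, dist_comm, hac]; norm_num
  have n3 : ⟪w3, w3⟫ = 1 := by rw [real_inner_self_eq_norm_sq, hw3, ← dist_eq_norm, hpa]; norm_num
  have i12 : ⟪w1, w2⟫ = 1 / 2 := by rw [hw1, hw2]; exact inner_eq_half_of_unit_triangle hab hac hbc
  have i13 : ⟪w1, w3⟫ = 1 / 2 := by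
    rw [hw1, hw3]; exact inner_eq_half_of_unit_triangle hab (by rw [dist_comm]; exact hpa) (by rw [dist_comm]; exact hpb)
  have i23 : ⟪w2, w3⟫ = 1 / 2 := by
    rw [hw2, hw3]; exact inner_eq_half_of_unit_triangle hac (by rw [dist_comm]; exact hpa) (by rw [dist_comm]; exact hpc)
  have i21 : ⟪w2, w1⟫ = 1 / 2 := by rw [real_inner_comm]; exact i12
  have i31 : ⟪w3, w1⟫ = 1 / 2 := by rw [real_inner_comm]; exact i13
  have i32 : ⟪w3, w2⟫ = 1 / 2 := by rw [real_inner_comm]; exact i23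
  -- r := q - a
  obtain ⟨r, hr⟩ : ∃ r : EuclideanSpace ℝ (Fin d), r = (2 / 3 : ℝ) • w1 + (2 / 3 : ℝ) • w2 - w3 := ⟨_, rfl⟩
  have hqa : q - a = r := by simp only [q, hr, hw1, hw2, hw3]; abel
  have hrr : ⟪r, r⟫ = 1 := by
    rw [hr]
    simp only [inner_add_left, inner_add_right, inner_sub_left, inner_sub_right, real_inner_smul_left,
      real_inner_smul_right, n1, n2, n3, i12, i13, i23, i21, i31, i32]
    norm_num
  have hr1 : ⟪r, w1⟫ = 1 / 2 := by
    rw [hr]; simp only [inner_add_left, inner_sub_left, real_inner_smul_left, n1, i21, i31]; norm_num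
  have hr2 : ⟪r, w2⟫ = 1 / 2 := by
    rw [hr]; simp only [inner_add_left, inner_sub_left, real_inner_smul_left, n2, i12, i32]; norm_num
  have hr3 : ⟪r, w3⟫ = -(1 / 3) := by
    rw [hr]; simp only [inner_add_left, inner_sub_left, real_inner_smul_left, n3, i13, i23]; norm_num
  have hda : dist q a = 1 := by
    rw [dist_eq_norm, hqa, ← Real.sqrt_sq (norm_nonneg r), ← real_inner_self_eq_norm_sq, hrr, Real.sqrt_one]
  have key : ∀ (y : EuclideanSpace ℝ (Fin d)) (w : EuclideanSpace ℝ (Fin d)), y - a = w →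
      dist q y ^ 2 = ⟪r, r⟫ - 2 * ⟪r, w⟫ + ⟪w, w⟫ := by
    intro y w hw
    have : q - y = r - w := by rw [← hqa, ← hw]; abel
    rw [dist_eq_norm, this, ← real_inner_self_eq_norm_sq, inner_sub_left, inner_sub_right, inner_sub_right,
      real_inner_comm w r]
    ring
  refine ⟨hda, ?_, ?_, ?_⟩
  · have h := key b w1 hw1.symm
    rw [hrr, hr1, n1] at h
    nlinarith [dist_nonneg (x := q) (y := b)]
  · have h := key c w2 hw2.symm
    rw [hrr, hr2, n2] at h
    nlinarith [dist_nonneg (x := q) (y := c)]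
  · have h := key p w3 hw3.symm
    rw [hrr, hr3, n3] at h
    linarith

/-- **Four pairwise touching balls have an exposed triangle**: a point at distance `≥ 1` from all four centres and at
distance exactly `1` from three of them. [folklore] -/
theorem exists_docking_of_pairwise_touching {x : Fin 4 → EuclideanSpace ℝ (Fin d)}
    (h : ∀ i j, i ≠ j → dist (x i) (x j) = 1) :
    ∃ q : EuclideanSpace ℝ (Fin d), (∀ i, 1 ≤ dist q (x i)) ∧
      3 ≤ (univ.filter fun i : Fin 4 => dist q (x i) = 1).card := by
  classical
  obtain ⟨h0, h1, h2, h3⟩ := reflected_apex_dist (a := x 0) (b := x 1) (c := x 2) (p := x 3)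
    (h 0 1 (by decide)) (h 0 2 (by decide)) (h 1 2 (by decide))
    (h 3 0 (by decide)) (h 3 1 (by decide)) (h 3 2 (by decide))
  refine ⟨x 0 + ((2 / 3 : ℝ) • (x 1 - x 0) + (2 / 3 : ℝ) • (x 2 - x 0) - (x 3 - x 0)), ?_, ?_⟩
  · intro i
    fin_cases i
    · exact le_of_eq h0.symm
    · exact le_of_eq h1.symm
    · exact le_of_eq h2.symm
    · show (1 : ℝ) ≤ dist _ (x 3)
      nlinarith [dist_nonneg (x := x 0 + ((2 / 3 : ℝ) • (x 1 - x 0) + (2 / 3 : ℝ) • (x 2 - x 0) - (x 3 - x 0))) (y := x 3), h3]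
  · have hsub : ({0, 1, 2} : Finset (Fin 4)) ⊆
        univ.filter fun i : Fin 4 => dist (x 0 + ((2 / 3 : ℝ) • (x 1 - x 0) + (2 / 3 : ℝ) • (x 2 - x 0) - (x 3 - x 0))) (x i) = 1 := by
      intro i hi
      simp only [mem_insert, mem_singleton] at hi
      rw [mem_filter]
      rcases hi with rfl | rfl | rfl
      · exact ⟨mem_univ _, h0⟩
      · exact ⟨mem_univ _, h1⟩
      · exact ⟨mem_univ _, h2⟩
    exact le_trans (by decide) (card_le_card hsub)

/-- **Base case of the Bezdek–Khan induction at `n = 4`**: every maximal four-ball packing in `ℝ³` (six contacts) has an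
exposed triangle (in the unfolded form of `HasExposedTriangle`). [folklore] -/
theorem exists_docking_of_maximal_four {x : Fin 4 → EuclideanSpace ℝ (Fin 3)} (hxe : numContacts x = maxContacts 3 4) :
    ∃ q : EuclideanSpace ℝ (Fin 3), (∀ i, 1 ≤ dist q (x i)) ∧ 3 ≤ (univ.filter fun i : Fin 4 => dist q (x i) = 1).card :=
  exists_docking_of_pairwise_touching fun _ _ hij =>
    dist_eq_one_of_numContacts_eq_six (by rw [hxe, maxContacts_three_four]) hij

end Summit.Ventures.Crystal3D

end
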